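import Literature.NumberTheory.Automorphic.BrandtHeckeProjector
import Literature.NumberTheory.Automorphic.DefiniteOrderUnitsCardDvd
import Literature.NumberTheory.Automorphic.BrandtMultiplicativityHolds
import HarnessLib

/-!
# The lattice congruence number of a Brandt eigen-line divides `12 ×` its ring congruence number

Topic `NumberTheory/Automorphic`; theorems only (no definition, no named fact, no instance).
Companion of `BrandtHeckeProjector.lean` (which proves that SOME positive multiple `D · π_φ` of the
`w`-orthogonal projector onto an eigen-line is an integral Hecke operator).  Here the converse
bookkeeping: EVERY element of the anemic integral Hecke algebra that annihilates the eigencharacter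
is such a multiple, and its eigenvalue `D` is divisible by the lattice congruence number up to the
unit indices.

Setting (abstract layer).  `ι` a finite index type, `w : ι → ℕ` weights, `N : ℕ`,
`T : ℕ → Matrix ι ι ℤ` with the `T(p)`, `p` prime, `p ∤ N`, pairwise COMMUTING and `w`-SYMMETRIC
(`w_i T(p)_ij = w_j T(p)_ji`), `λ : ℕ → ℤ`, and suppose the eigen-lattice
`L(λ) = {v : T(p) v = λ(p) v for all primes p ∤ N}` (`Brandt.eigenLattice`) is a line `ℤ φ`, `φ ≠ 0`;
`ξ = xi w L(λ) = Σ_i w_i φ_i²` (`Brandt.xi`).  Let `𝕋⁰ = ℤ[T(p) : p prime, p ∤ N] ⊆ M_ι(ℤ)` be the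
anemic Hecke algebra (Mathlib's `Algebra.adjoin`, written out in each statement) and, for `M ∈ 𝕋⁰`,
say that `M` ANNIHILATES THE EIGENCHARACTER if `M · (T(p) − λ(p)) = 0` for all primes `p ∤ N`
(these differences generate the kernel of the eigencharacter `𝕋⁰ → ℤ`, `T(p) ↦ λ(p)`, so this is
membership in `Ann_{𝕋⁰}(ker)`, the ideal whose image is the congruence ideal `η` of Wiles, Lenstra and
Diamond; cf. `Literature.RingTheory.CompleteIntersection.congruenceIdeal`).

* `Brandt.commute_of_mem_heckeAdjoin`, `Brandt.mul_comm_of_mem_heckeAdjoin`,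
  `Brandt.wsymm_of_mem_heckeAdjoin` — `𝕋⁰` is commutative and consists of `w`-symmetric matrices.
* `Brandt.mulVec_mem_eigenLattice_of_mul_sub_eq_zero` — if `M ∈ 𝕋⁰` annihilates the eigencharacter,
  then `M v ∈ L(λ) = ℤ φ` for EVERY `v ∈ ℤ^ι` (so `M = D · π_φ` on `ℚ^ι`, `M φ = D φ`).
* `Brandt.xi_mul_apply_eq_of_mulVec_mem_span` — a `w`-symmetric `M` with range in `ℤ φ` and
  `M φ = D φ` satisfies `ξ · M_cd = D · w_d φ_d φ_c` (the identity behind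
  `Brandt.exists_heckeProjector`, isolated).
* `Brandt.exists_sum_mul_eq_one_of_eigenLattice_eq_span` — a generator of the (saturated)
  eigen-lattice is primitive (Bezout form `Σ u_i φ_i = 1`).
* `Brandt.xi_dvd_mul_of_forall_xi_mul_apply_eq` — hence `ξ ∣ W · D` as soon as every `w_d ∣ W`.
* `Brandt.XiSetup.xi_dvd_twelve_mul_of_mul_sub_eq_zero` — **for a Brandt setup `S` of type
  `(N⁺, N⁻)`** (definite quaternion algebra over `ℚ`; commuting Brandt matrices
  `Brandt.XiSetup.matrix_comm_of_coprime`, Eichler's weight symmetry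
  `Brandt.XiSetup.weight_mul_matrix_symm`, `w_c ∣ 12` by `Brandt.XiSetup.weight_dvd_twelve`):
  if `M ∈ ℤ[B(p) : p ∤ N⁺N⁻]` annihilates the eigencharacter of the line `ℤ φ` and `M φ = D φ`, then
  `S.xi λ ∣ 12 · D`.  In words: the LATTICE congruence number `ξ = ⟨φ, φ⟩_w` of Pollack–Weston
  2011 §2.1 (Gross 1987) divides `12 ×` every element of the RING congruence ideal
  `η = {D : D · π_φ ∈ 𝕋⁰}` (Diamond 1997 §; de Smit–Rubin–Schoof 1997), whatever the Gorenstein or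
  multiplicity-one properties of the Brandt module (which govern the converse divisibility,
  Calegari–Emerton 2005 at `p = 2`).

Proofs are elementary: commutativity makes `T(p) M = λ(p) M` from `M T(p) = λ(p) M`, so `M v` is a
common eigenvector; `w`-symmetry and `⟨M e_d, φ⟩_w = ⟨e_d, M φ⟩_w` give the projector shape; Bezout
twice (primitivity of `φ`, then `w_d ∣ 12`) gives the divisibility.  The primitivity lemma is the
Literature copy of `Summit.ABC.ABC.Theorems.XiBoundXiDvdTwelve.exists_sum_mul_eq_one_of_eigenLine`
(Summits-side, not importable here).

What is NOT here: the eigencharacter as a ring homomorphism, the identification of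
`{M : M (T(p) − λ(p)) = 0 ∀ p}` with `Ann_{𝕋⁰}(ker)` and of `η` with
`Literature.RingTheory.CompleteIntersection.congruenceIdeal` (these need `𝕋⁰` packaged as a
commutative ring with an augmentation — a definition), Lenstra's bound `Fit₀(ker/ker²) ⊆ η`
(in tree: `Literature.RingTheory.CompleteIntersection.fittingIdeal_cotangentModule_le_congruenceIdeal`)
and any arithmetic bound on `η`.

## References

* R. Pollack, T. Weston, *On anticyclotomic μ-invariants of modular forms*, Compos. Math. 147
  (2011), §2.1 [PollackWeston2011].
* F. Diamond, *The Taylor–Wiles construction and multiplicity one*, Invent. Math. 128 (1997)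
  [Diamond1997].
* B. de Smit, K. Rubin, R. Schoof, *Criteria for complete intersections*, in: Modular Forms and
  Fermat's Last Theorem, Springer 1997 [DeSmitRubinSchoof1997].
* F. Calegari, M. Emerton, *On the ramification of Hecke algebras at Eisenstein primes*,
  Invent. Math. 160 (2005) [CalegariEmerton2005].
-/

open scoped Matrix

namespace Literature.NumberTheory.Automorphic

namespace Brandt

variable {ι : Type*} [Fintype ι]

/-! ### The anemic Hecke algebra: commutativity and weight symmetry -/

section Abstract

variable [DecidableEq ι]

/-- If the `T(p)`, `p` prime, `p ∤ N`, pairwise commute, then each `T(p)` commutes with every element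
of the anemic Hecke algebra `ℤ[T(p) : p ∤ N]`. [folklore] -/
theorem commute_of_mem_heckeAdjoin {N : ℕ} {T : ℕ → Matrix ι ι ℤ}
    (hcomm : ∀ p q : ℕ, p.Prime → ¬ p ∣ N → q.Prime → ¬ q ∣ N → T p * T q = T q * T p)
    {M : Matrix ι ι ℤ}
    (hM : M ∈ Algebra.adjoin ℤ {X : Matrix ι ι ℤ | ∃ p : ℕ, p.Prime ∧ ¬ p ∣ N ∧ X = T p})
    {p : ℕ} (hp : p.Prime) (hpN : ¬ p ∣ N) : Commute (T p) M :=
  Algebra.commute_of_mem_adjoin_of_forall_mem_commute hM fun X hX => by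
    obtain ⟨q, hq, hqN, rfl⟩ := hX
    exact hcomm p q hp hpN hq hqN

/-- The anemic Hecke algebra of pairwise commuting `T(p)` is commutative. [folklore] -/
theorem mul_comm_of_mem_heckeAdjoin {N : ℕ} {T : ℕ → Matrix ι ι ℤ}
    (hcomm : ∀ p q : ℕ, p.Prime → ¬ p ∣ N → q.Prime → ¬ q ∣ N → T p * T q = T q * T p)
    {M M' : Matrix ι ι ℤ}
    (hM : M ∈ Algebra.adjoin ℤ {X : Matrix ι ι ℤ | ∃ p : ℕ, p.Prime ∧ ¬ p ∣ N ∧ X = T p})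
    (hM' : M' ∈ Algebra.adjoin ℤ {X : Matrix ι ι ℤ | ∃ p : ℕ, p.Prime ∧ ¬ p ∣ N ∧ X = T p}) :
    M * M' = M' * M :=
  (Algebra.commute_of_mem_adjoin_of_forall_mem_commute hM' fun X hX => by
    obtain ⟨q, hq, hqN, rfl⟩ := hX
    exact (commute_of_mem_heckeAdjoin hcomm hM hq hqN).symm).eq

/-- Elements of the anemic Hecke algebra of commuting `w`-symmetric matrices are `w`-symmetric
(`w_i M_ij = w_j M_ji`), i.e. self-adjoint for `⟪x, y⟫_w = Σ_i w_i x_i y_i`. [folklore] -/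
theorem wsymm_of_mem_heckeAdjoin (w : ι → ℕ) {N : ℕ} {T : ℕ → Matrix ι ι ℤ}
    (hT : ∀ p : ℕ, p.Prime → ¬ p ∣ N → ∀ i j, (w i : ℤ) * T p i j = (w j : ℤ) * T p j i)
    (hcomm : ∀ p q : ℕ, p.Prime → ¬ p ∣ N → q.Prime → ¬ q ∣ N → T p * T q = T q * T p)
    {M : Matrix ι ι ℤ}
    (hM : M ∈ Algebra.adjoin ℤ {X : Matrix ι ι ℤ | ∃ p : ℕ, p.Prime ∧ ¬ p ∣ N ∧ X = T p}) :
    ∀ i j, (w i : ℤ) * M i j = (w j : ℤ) * M j i := by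
  induction hM using Algebra.adjoin_induction with
  | mem X hX =>
    obtain ⟨p, hp, hpN, rfl⟩ := hX
    exact hT p hp hpN
  | algebraMap r =>
    rw [Algebra.algebraMap_eq_smul_one]
    exact wsymm_smul (wsymm_one w) r
  | add X Y _ _ hx hy => exact wsymm_add hx hy
  | mul X Y hX hY hx hy => exact wsymm_mul_of_commute hx hy (mul_comm_of_mem_heckeAdjoin hcomm hX hY)

/-! ### Annihilators of the eigencharacter are multiples of the projector -/

/-- **An element of the anemic Hecke algebra that annihilates the eigencharacter maps `ℤ^ι` into the
eigen-lattice.**  If `M ∈ ℤ[T(p) : p ∤ N]` satisfies `M · (T(p) − λ(p)) = 0` for all primes `p ∤ N`,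
then `M v ∈ L(λ)` for every `v`: indeed `T(p) (M v) = (M T(p)) v = λ(p) M v` by commutativity. [folklore] -/
theorem mulVec_mem_eigenLattice_of_mul_sub_eq_zero {N : ℕ} {T : ℕ → Matrix ι ι ℤ} (lam : ℕ → ℤ)
    (hcomm : ∀ p q : ℕ, p.Prime → ¬ p ∣ N → q.Prime → ¬ q ∣ N → T p * T q = T q * T p)
    {M : Matrix ι ι ℤ}
    (hM : M ∈ Algebra.adjoin ℤ {X : Matrix ι ι ℤ | ∃ p : ℕ, p.Prime ∧ ¬ p ∣ N ∧ X = T p})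
    (hkill : ∀ p : ℕ, p.Prime → ¬ p ∣ N → M * (T p - lam p • (1 : Matrix ι ι ℤ)) = 0)
    (v : ι → ℤ) : M *ᵥ v ∈ eigenLattice N T lam := by
  intro p hp hpN
  have h1 : M * T p = lam p • M := by
    have h := hkill p hp hpN
    rwa [mul_sub, Matrix.mul_smul, mul_one, sub_eq_zero] at h
  have h2 : T p * M = lam p • M := by
    rw [(commute_of_mem_heckeAdjoin hcomm hM hp hpN).eq, h1]
  rw [Matrix.mulVec_mulVec, h2, Matrix.smul_mulVec]

/-- **Projector shape.**  A `w`-symmetric matrix `M` whose range lies in the line `ℤ φ` (`φ ≠ 0`,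
`L = ℤ φ`) and with `M φ = D φ` satisfies `ξ · M_cd = D · w_d φ_d φ_c`, `ξ = xi w L = Σ_i w_i φ_i²`:
pair `M e_d = c_d φ` with `φ` and use `⟪M e_d, φ⟫_w = ⟪e_d, M φ⟫_w = D w_d φ_d`
(the computation in the proof of `Brandt.exists_heckeProjector`). [cite: PollackWeston2011, §2.1] -/
theorem xi_mul_apply_eq_of_mulVec_mem_span (w : ι → ℕ) {M : Matrix ι ι ℤ}
    (hsymm : ∀ i j, (w i : ℤ) * M i j = (w j : ℤ) * M j i) {φ : ι → ℤ} (hφ : φ ≠ 0)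
    {L : Submodule ℤ (ι → ℤ)} (hL : L = ℤ ∙ φ)
    (hrange : ∀ v, M *ᵥ v ∈ (ℤ ∙ φ : Submodule ℤ (ι → ℤ))) {D : ℤ} (hD : M *ᵥ φ = D • φ) :
    ∀ c d, (xi w L : ℤ) * M c d = D * (w d : ℤ) * φ d * φ c := by
  -- the key identity `⟪φ, φ⟫_w · M v = D ⟪v, φ⟫_w · φ`
  have hkey : ∀ v, (∑ i, (w i : ℤ) * φ i * φ i) • (M *ᵥ v) =
      (D * ∑ i, (w i : ℤ) * v i * φ i) • φ := fun v => by
    obtain ⟨c, hc⟩ := Submodule.mem_span_singleton.mp (hrange v)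
    have h1 : ∑ i, (w i : ℤ) * (M *ᵥ v) i * φ i = c * ∑ i, (w i : ℤ) * φ i * φ i := by
      rw [← hc, wpair_smul_left]
    have h2 : ∑ i, (w i : ℤ) * (M *ᵥ v) i * φ i = D * ∑ i, (w i : ℤ) * v i * φ i := by
      rw [wpair_mulVec w hsymm, hD, wpair_smul_right]
    rw [← hc, smul_smul, mul_comm, ← h1, h2]
  -- entries
  have hentry : ∀ c d, (∑ i, (w i : ℤ) * φ i * φ i) * M c d =
      D * (w d : ℤ) * φ d * φ c := fun c d => by
    have h := congrFun (hkey (Pi.single d 1)) c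
    rw [Matrix.mulVec_single_one, wpair_single_left] at h
    simp only [Pi.smul_apply, smul_eq_mul, Matrix.col_apply] at h
    rw [h]; ring
  -- `ξ = ⟪φ, φ⟫_w`
  have hxi : (xi w L : ℤ) = ∑ i, (w i : ℤ) * φ i * φ i := by
    rw [xi_eq_sum w hφ hL]
    push_cast
    refine Finset.sum_congr rfl fun i _ => ?_
    rw [sq_abs]; ring
  intro c d
  rw [hxi, hentry]

end Abstract

/-! ### Primitivity and the divisibility `ξ ∣ W · D` -/

/-- **A generator of the eigen-line is primitive**: if the (saturated) eigen-lattice is `ℤ φ` with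
`φ ≠ 0`, the coordinates of `φ` generate the unit ideal of `ℤ`: `Σ_i u_i φ_i = 1` for some `u`.
(Write `φ = g ψ` with `g` a generator of the ideal `(φ_i)_i`; saturation
`Brandt.mem_eigenLattice_of_smul_mem` puts `ψ` in `ℤ φ`, forcing `g` to be a unit.)  Literature copy of
the Summits-side `XiBoundXiDvdTwelve.exists_sum_mul_eq_one_of_eigenLine`. [folklore] -/
theorem exists_sum_mul_eq_one_of_eigenLattice_eq_span {N : ℕ} {T : ℕ → Matrix ι ι ℤ} {lam : ℕ → ℤ}
    {φ : ι → ℤ} (hφ : φ ≠ 0) (hL : eigenLattice N T lam = ℤ ∙ φ) :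
    ∃ u : ι → ℤ, ∑ i, u i * φ i = 1 := by
  classical
  set J : Ideal ℤ := Ideal.span (Set.range φ) with hJ
  set g : ℤ := Submodule.IsPrincipal.generator J with hg
  have hgJ : Ideal.span {g} = J := Ideal.span_singleton_generator J
  have hdvd : ∀ i, ∃ c, φ i = g * c := fun i =>
    (Submodule.IsPrincipal.mem_iff_generator_dvd J).mp (Ideal.subset_span ⟨i, rfl⟩)
  choose ψ hψ using hdvd
  have hφψ : φ = g • ψ := funext fun i => by rw [Pi.smul_apply, smul_eq_mul]; exact hψ i
  have hg0 : g ≠ 0 := fun h0 => hφ (by rw [hφψ, h0, zero_smul])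
  -- saturation: `ψ ∈ L = ℤ φ`
  have hψL : ψ ∈ eigenLattice N T lam := by
    refine mem_eigenLattice_of_smul_mem hg0 ?_
    rw [← hφψ, hL]
    exact Submodule.mem_span_singleton_self φ
  rw [hL] at hψL
  obtain ⟨a, ha⟩ := Submodule.mem_span_singleton.mp hψL
  obtain ⟨i, hi⟩ : ∃ i, φ i ≠ 0 := Function.ne_iff.mp hφ
  have hga : g * a = 1 := by
    have h1 : φ i = g * a * φ i := by
      have := congrFun ha i
      rw [Pi.smul_apply, smul_eq_mul] at this
      rw [mul_assoc, this, ← hψ i]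
    have h2 : (g * a - 1) * φ i = 0 := by rw [sub_mul, one_mul, ← h1, sub_self]
    exact sub_eq_zero.mp ((mul_eq_zero.mp h2).resolve_right hi)
  have h1J : (1 : ℤ) ∈ J := by
    rw [← hgJ, Ideal.span_singleton_eq_top.mpr (IsUnit.of_mul_eq_one a hga)]
    exact Submodule.mem_top
  exact Ideal.mem_span_range_iff_exists_fun.mp h1J

/-- **Bezout transport of divisibility**: if `Σ_i u_i φ_i = 1` and `m ∣ n φ_i` for all `i`, then
`m ∣ n`. [folklore] -/
theorem dvd_of_forall_dvd_mul_coord {u φ : ι → ℤ} (hu : ∑ i, u i * φ i = 1)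
    {m n : ℤ} (h : ∀ i, m ∣ n * φ i) : m ∣ n := by
  have e : n = ∑ i, u i * (n * φ i) := by
    calc n = n * ∑ i, u i * φ i := by rw [hu, mul_one]
      _ = ∑ i, u i * (n * φ i) := by
        rw [Finset.mul_sum]
        exact Finset.sum_congr rfl fun i _ => by ring
  rw [e]
  exact Finset.dvd_sum fun i _ => (h i).mul_left _

/-- **`ξ ∣ W · D` from the projector shape.**  If `φ` is primitive (`Σ u_i φ_i = 1`), every weight
divides `W` (`w_d ∣ W`), and the integer matrix `M` satisfies `ξ · M_cd = D · w_d φ_d φ_c` for all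
`c, d`, then `ξ ∣ W · D`: Bezout in `c` gives `ξ ∣ D w_d φ_d`, then `w_d ∣ W` and Bezout in `d`. [folklore] -/
theorem xi_dvd_mul_of_forall_xi_mul_apply_eq {w : ι → ℕ} {φ : ι → ℤ} {M : Matrix ι ι ℤ} {ξ D W : ℤ}
    (hu : ∃ u : ι → ℤ, ∑ i, u i * φ i = 1) (hW : ∀ d, (w d : ℤ) ∣ W)
    (h : ∀ c d, ξ * M c d = D * (w d : ℤ) * φ d * φ c) : ξ ∣ W * D := by
  obtain ⟨u, hu⟩ := hu
  -- `ξ ∣ D w_d φ_d` for every `d`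
  have h1 : ∀ d, ξ ∣ D * (w d : ℤ) * φ d := fun d =>
    dvd_of_forall_dvd_mul_coord hu fun c => ⟨M c d, by rw [h c d]⟩
  -- `ξ ∣ W D φ_d` since `w_d ∣ W`
  have h2 : ∀ d, ξ ∣ W * D * φ d := fun d => by
    obtain ⟨k, hk⟩ := hW d
    rw [hk, show (w d : ℤ) * k * D * φ d = D * (w d : ℤ) * φ d * k by ring]
    exact (h1 d).mul_right _
  exact dvd_of_forall_dvd_mul_coord hu h2

/-! ### Brandt setups: `ξ ∣ 12 · η` -/

open scoped Classical in
/-- **The lattice congruence number divides `12 ×` the ring congruence number** (definite quaternion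
setting of Pollack–Weston 2011 §2.1; the congruence ideal in the sense of Diamond 1997 / de
Smit–Rubin–Schoof 1997).  Let `S` be a Brandt setup of type `(N⁺, N⁻)`, `λ` an eigenvalue system whose
eigen-lattice (Brandt matrices `B(p)`, primes `p ∤ N⁺N⁻`) is the line `ℤ φ`, `φ ≠ 0`, and let
`M ∈ ℤ[B(p) : p prime, p ∤ N⁺N⁻]` annihilate the eigencharacter, `M · (B(p) − λ(p)) = 0` for all such
`p` (equivalently `M = D · π_φ` is a multiple of the `w`-orthogonal projector onto `ℚ φ`), with
`M φ = D φ`.  Then `S.xi λ ∣ 12 · D`.  Ingredients: commuting Brandt matrices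
(`Brandt.XiSetup.matrix_comm_of_coprime`), Eichler's weight symmetry
(`Brandt.XiSetup.weight_mul_matrix_symm`), `w_c ∣ 12` (`Brandt.XiSetup.weight_dvd_twelve`), and the
abstract lemmas above.  Some such `M` with `D > 0` exists (`Brandt.XiSetup.exists_heckeProjector_xi`,
for the larger algebra `ℤ[B(n) : n ≥ 1]`; the same proof runs in the anemic one). [cite: PollackWeston2011, §2.1] -/
theorem XiSetup.xi_dvd_twelve_mul_of_mul_sub_eq_zero {Nplus Nminus : ℕ} (S : XiSetup Nplus Nminus)
    [Fintype (ClassSet S.O)] (lam : ℕ → ℤ) {φ : ClassSet S.O → ℤ} (hφ : φ ≠ 0)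
    (hL : eigenLattice (Nplus * Nminus) (Brandt.matrix S.O) lam = ℤ ∙ φ)
    {M : Matrix (ClassSet S.O) (ClassSet S.O) ℤ}
    (hM : M ∈ Algebra.adjoin ℤ {X : Matrix (ClassSet S.O) (ClassSet S.O) ℤ |
      ∃ p : ℕ, p.Prime ∧ ¬ p ∣ Nplus * Nminus ∧ X = Brandt.matrix S.O p})
    (hkill : ∀ p : ℕ, p.Prime → ¬ p ∣ Nplus * Nminus →
      M * (Brandt.matrix S.O p - lam p • (1 : Matrix (ClassSet S.O) (ClassSet S.O) ℤ)) = 0)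
    {D : ℤ} (hD : M *ᵥ φ = D • φ) :
    (S.xi lam : ℤ) ∣ 12 * D := by
  -- commuting, `w`-symmetric generators
  have hcomm : ∀ p q : ℕ, p.Prime → ¬ p ∣ Nplus * Nminus → q.Prime → ¬ q ∣ Nplus * Nminus →
      Brandt.matrix S.O p * Brandt.matrix S.O q = Brandt.matrix S.O q * Brandt.matrix S.O p := by
    intro p q hp _ hq _
    by_cases hpq : p = q
    · rw [hpq]
    · exact S.matrix_comm_of_coprime ((Nat.coprime_primes hp hq).mpr hpq)
  have hT : ∀ p : ℕ, p.Prime → ¬ p ∣ Nplus * Nminus → ∀ i j,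
      (weight S.O i : ℤ) * Brandt.matrix S.O p i j = (weight S.O j : ℤ) * Brandt.matrix S.O p j i :=
    fun p _ _ i j => S.weight_mul_matrix_symm p i j
  have hsymm := wsymm_of_mem_heckeAdjoin (weight S.O) hT hcomm hM
  have hrange : ∀ v, M *ᵥ v ∈ (ℤ ∙ φ : Submodule ℤ (ClassSet S.O → ℤ)) := fun v => by
    rw [← hL]
    exact mulVec_mem_eigenLattice_of_mul_sub_eq_zero lam hcomm hM hkill v
  have hshape := xi_mul_apply_eq_of_mulVec_mem_span (weight S.O) hsymm hφ hL hrange hD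
  have hxi : (S.xi lam : ℤ) =
      (Brandt.xi (weight S.O) (eigenLattice (Nplus * Nminus) (Brandt.matrix S.O) lam) : ℤ) := by
    rw [XiSetup.xi, xiOfOrder_eq]
  rw [hxi]
  exact xi_dvd_mul_of_forall_xi_mul_apply_eq (exists_sum_mul_eq_one_of_eigenLattice_eq_span hφ hL)
    (fun d => by exact_mod_cast S.weight_dvd_twelve d) hshape

open scoped Classical in
/-- **Every annihilator of the eigencharacter acts on `φ` by an integer `D` with `ξ ∣ 12 D`** — the
hypothesis `M φ = D φ` of `XiSetup.xi_dvd_twelve_mul_of_mul_sub_eq_zero` is automatic (`M φ ∈ ℤ φ`),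
so the conclusion can be stated as an existence. [cite: PollackWeston2011, §2.1] -/
theorem XiSetup.exists_mulVec_eq_smul_and_xi_dvd {Nplus Nminus : ℕ} (S : XiSetup Nplus Nminus)
    [Fintype (ClassSet S.O)] (lam : ℕ → ℤ) {φ : ClassSet S.O → ℤ} (hφ : φ ≠ 0)
    (hL : eigenLattice (Nplus * Nminus) (Brandt.matrix S.O) lam = ℤ ∙ φ)
    {M : Matrix (ClassSet S.O) (ClassSet S.O) ℤ}
    (hM : M ∈ Algebra.adjoin ℤ {X : Matrix (ClassSet S.O) (ClassSet S.O) ℤ |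
      ∃ p : ℕ, p.Prime ∧ ¬ p ∣ Nplus * Nminus ∧ X = Brandt.matrix S.O p})
    (hkill : ∀ p : ℕ, p.Prime → ¬ p ∣ Nplus * Nminus →
      M * (Brandt.matrix S.O p - lam p • (1 : Matrix (ClassSet S.O) (ClassSet S.O) ℤ)) = 0) :
    ∃ D : ℤ, M *ᵥ φ = D • φ ∧ (S.xi lam : ℤ) ∣ 12 * D := by
  have hcomm : ∀ p q : ℕ, p.Prime → ¬ p ∣ Nplus * Nminus → q.Prime → ¬ q ∣ Nplus * Nminus →
      Brandt.matrix S.O p * Brandt.matrix S.O q = Brandt.matrix S.O q * Brandt.matrix S.O p := by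
    intro p q hp _ hq _
    by_cases hpq : p = q
    · rw [hpq]
    · exact S.matrix_comm_of_coprime ((Nat.coprime_primes hp hq).mpr hpq)
  have hmem : M *ᵥ φ ∈ (ℤ ∙ φ : Submodule ℤ (ClassSet S.O → ℤ)) := by
    rw [← hL]
    exact mulVec_mem_eigenLattice_of_mul_sub_eq_zero lam hcomm hM hkill φ
  obtain ⟨D, hD⟩ := Submodule.mem_span_singleton.mp hmem
  exact ⟨D, hD.symm, S.xi_dvd_twelve_mul_of_mul_sub_eq_zero lam hφ hL hM hkill hD.symm⟩

end Brandt

end Literature.NumberTheory.Automorphic
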